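import Summits.CriticalPhenomena.PercolationContinuityZ3.Theorems.PercNearOneGluingNoHeavyLowerTailAGPlusBernsteinStep
import Summits.CriticalPhenomena.PercolationContinuityZ3.Theorems.PercNearOneGluingNoHeavyLowerTailTIncBernsteinMeasure
import Summits.CriticalPhenomena.PercolationContinuityZ3.Theorems.PercNearOneGluingNoHeavyLowerTailHqtBernsteinFaceRestriction
import Summits.CriticalPhenomena.PercolationContinuityZ3.Theorems.PercNearOneGluingNoHeavyLowerTailBernsteinPieces
import Mathlib.Tactic.Linarith
import HarnessLib

/-!
# `NoHeavyLowerTail` (stmt-CriticalPhenomena-4575) — (BΞ1),(BΞ2) for AG⁺, IV: the MEASURE-LEVEL statements (`bernsteinCells` vocabulary) and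
# prim-bnk-1's rung `TerminalEdgeStep.XiStepUpTo N₀` for EVERY `N₀` (in the tree so far only `N₀ = 5`, by `native_decide`)

Support file (prover prim-l12-p6 gen 3; `--supports stmt-CriticalPhenomena-4575`).  No definitions, no named facts, no sorries.
For `μ = prodBernoulli w` on a finite vertex type and ANY `a b c y`, with `m` the ten masses of `bernsteinCells a b c y`:
* `xiBernsteinPieces` : `0 ≤ xiB₁ (m 0) … (m 9) ∧ 0 ≤ xiB₂ (m 0) … (m 9)` (from `AGPlusFibre.xiStep` at `D = univ`, `K = ∅`, plus the dictionary
  finite sums ↔ `prodBernoulli` of `…TIncBernsteinMeasure`; the case `a = y` separately: no transitions, `3·Ξ ≥ 0`);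
* `xiStep_all` : the same in prim-bnk-1's vocabulary `E3GroupSepCert.lq/lu₁/lu₂/lu₃/lt`, `TerminalEdgeStep.lα₁/lα₂/lβ₁/lβ₂/lβ₃` on `Fin n`, all `n`;
* **`xiStepUpTo_all : ∀ N₀, TerminalEdgeStep.XiStepUpTo N₀`** — the AG⁺ terminal-edge step (BΞ1),(BΞ2) on every finite weighted graph.
prim-facecert (FINDING-FACE-PSEUDOLAWS.md) showed that (BΞ1),(BΞ2) have NO multiplier certificate over the proved four-point rows; the proof here is
the fibrewise positivity of prim-ineq-prove-3's three-copy exchange certificate I4 (`…AGPlusBernsteinFibre`).  [this work]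
-/

noncomputable section

namespace Summit.CriticalPhenomena.PercolationContinuityZ3.Theorems

namespace AGPlusFibre

open Finset Literature.Probability.Percolation Literature.Probability.Percolation.DecisionTree
open Literature.Probability.Percolation.Gladkov ThreePointLB TIncSwitching CubicThreePointStep ThreePointGamma TIncFibre
open CubicThreePointTerminal (Xi)
open TerminalEdgeStep (xiB₁ xiB₂)
open MeasureTheory Literature.Probability.LatticeModels
open scoped Classical

variable {V : Type} [Fintype V]



/-- **(BΞ1),(BΞ2) for every four-point bond-percolation law.**  With `m` the ten masses of `bernsteinCells a b c y` under `prodBernoulli w`: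
`0 ≤ xiB₁ (m 0) … (m 9)` and `0 ≤ xiB₂ (m 0) … (m 9)` — the AG⁺ twins of `BernsteinPieceB1/B2`, unconditionally. [this work] -/
theorem xiBernsteinPieces (w : Sym2 V → unitInterval) (a b c y : V) :
    0 ≤ xiB₁ ((prodBernoulli w).real (bernsteinCells a b c y 0)) ((prodBernoulli w).real (bernsteinCells a b c y 1))
        ((prodBernoulli w).real (bernsteinCells a b c y 2)) ((prodBernoulli w).real (bernsteinCells a b c y 3))
        ((prodBernoulli w).real (bernsteinCells a b c y 4)) ((prodBernoulli w).real (bernsteinCells a b c y 5))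
        ((prodBernoulli w).real (bernsteinCells a b c y 6)) ((prodBernoulli w).real (bernsteinCells a b c y 7))
        ((prodBernoulli w).real (bernsteinCells a b c y 8)) ((prodBernoulli w).real (bernsteinCells a b c y 9)) ∧
      0 ≤ xiB₂ ((prodBernoulli w).real (bernsteinCells a b c y 0)) ((prodBernoulli w).real (bernsteinCells a b c y 1))
        ((prodBernoulli w).real (bernsteinCells a b c y 2)) ((prodBernoulli w).real (bernsteinCells a b c y 3))
        ((prodBernoulli w).real (bernsteinCells a b c y 4)) ((prodBernoulli w).real (bernsteinCells a b c y 5))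
        ((prodBernoulli w).real (bernsteinCells a b c y 6)) ((prodBernoulli w).real (bernsteinCells a b c y 7))
        ((prodBernoulli w).real (bernsteinCells a b c y 8)) ((prodBernoulli w).real (bernsteinCells a b c y 9)) := by
  set p : Sym2 V → ℝ := fun e => (w e : ℝ) with hp
  have hp0 : ∀ e, 0 ≤ p e := fun e => (w e).2.1
  have hp1 : ∀ e, p e ≤ 1 := fun e => (w e).2.2
  have hco : ∀ (S : Finset (Sym2 V)) (u v : V), CubicThreePointStep.R ∅ S u v ↔ (↑S : Set (Sym2 V)) ∈ openConn u v :=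
    fun S u v => R_empty_iff_openConn S u v
  -- the five three-point cells
  have e0 : (prodBernoulli w).real (bernsteinCells a b c y 0) = PrW Finset.univ p (evQ ∅ a b c) :=
    prodBernoulli_real_eq_PrW_univ w fun S => by
      simp only [mem_evQ, hco, bernsteinCells, Set.mem_inter_iff, Set.mem_compl_iff]; tauto
  have e1 : (prodBernoulli w).real (bernsteinCells a b c y 1) = PrW Finset.univ p (evU₁ ∅ a b c) :=
    prodBernoulli_real_eq_PrW_univ w fun S => by
      simp only [mem_evU₁, hco, bernsteinCells, Set.mem_inter_iff, Set.mem_compl_iff]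
  have e2 : (prodBernoulli w).real (bernsteinCells a b c y 2) = PrW Finset.univ p (evU₂ ∅ a b c) :=
    prodBernoulli_real_eq_PrW_univ w fun S => by
      simp only [mem_evU₂, hco, bernsteinCells, Set.mem_inter_iff, Set.mem_compl_iff]
  have e3 : (prodBernoulli w).real (bernsteinCells a b c y 3) = PrW Finset.univ p (evU₃ ∅ a b c) :=
    prodBernoulli_real_eq_PrW_univ w fun S => by
      simp only [mem_evU₃, hco, bernsteinCells, Set.mem_inter_iff, Set.mem_compl_iff]
  have e4 : (prodBernoulli w).real (bernsteinCells a b c y 4) = PrW Finset.univ p (evT ∅ a b c) :=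
    prodBernoulli_real_eq_PrW_univ w fun S => by
      simp only [mem_evT, hco, bernsteinCells, Set.mem_inter_iff]
  by_cases hay : a = y
  · -- degenerate apex pair: every transition cell is empty, both pieces are `3·T_inc`
    subst hay
    have hsym : ∀ u v : V, (openConn u v : Set (BondConfig V)) = openConn v u := fun u v => by
      ext ω; exact ⟨fun h => SimpleGraph.Reachable.symm h, fun h => SimpleGraph.Reachable.symm h⟩
    have z5 : (prodBernoulli w).real (bernsteinCells a b c a 5) = 0 := by
      rw [measureReal_def, show bernsteinCells a b c a 5 = ∅ from ?_, measure_empty, ENNReal.toReal_zero]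
      ext ω; simp only [bernsteinCells, Set.mem_inter_iff, Set.mem_compl_iff, Set.mem_empty_iff_false, iff_false, hsym b a]; tauto
    have z6 : (prodBernoulli w).real (bernsteinCells a b c a 6) = 0 := by
      rw [measureReal_def, show bernsteinCells a b c a 6 = ∅ from ?_, measure_empty, ENNReal.toReal_zero]
      ext ω; simp only [bernsteinCells, Set.mem_inter_iff, Set.mem_compl_iff, Set.mem_empty_iff_false, iff_false, hsym c a]; tauto
    have z7 : (prodBernoulli w).real (bernsteinCells a b c a 7) = 0 := by
      rw [measureReal_def, show bernsteinCells a b c a 7 = ∅ from ?_, measure_empty, ENNReal.toReal_zero]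
      ext ω; simp only [bernsteinCells, Set.mem_inter_iff, Set.mem_compl_iff, Set.mem_empty_iff_false, iff_false, hsym c a]; tauto
    have z8 : (prodBernoulli w).real (bernsteinCells a b c a 8) = 0 := by
      rw [measureReal_def, show bernsteinCells a b c a 8 = ∅ from ?_, measure_empty, ENNReal.toReal_zero]
      ext ω; simp only [bernsteinCells, Set.mem_inter_iff, Set.mem_compl_iff, Set.mem_empty_iff_false, iff_false, hsym b a]; tauto
    have z9 : (prodBernoulli w).real (bernsteinCells a b c a 9) = 0 := by
      rw [measureReal_def, show bernsteinCells a b c a 9 = ∅ from ?_, measure_empty, ENNReal.toReal_zero]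
      ext ω; simp only [bernsteinCells, Set.mem_inter_iff, Set.mem_compl_iff, Set.mem_empty_iff_false, iff_false, hsym b a]; tauto
    rw [z5, z6, z7, z8, z9, e0, e1, e2, e3, e4, TerminalEdgeStep.xiB₁_transition_zero, TerminalEdgeStep.xiB₂_transition_zero, evQ_empty, evU₁_empty, evU₂_empty, evU₃_empty, evT_empty]
    have h := xi_plain_nonneg hp0 hp1 Finset.univ a b c
    constructor <;> linarith
  -- generic apex pair: the step hypothesis at `D = univ`, `K = ∅`, `x = a`, `m = y`
  have hst := xiStep hp0 hp1 (D := Finset.univ) (a := a) (b := b) (c := c) (y := y)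
  have hap : ∀ (S : Finset (Sym2 V)) (v : V), CubicThreePointStep.R (insert s(a, y) ∅) S a v ↔
      CubicThreePointStep.R ∅ S a v ∨ CubicThreePointStep.R ∅ S y v := fun S v => R_apex_iff hay S v
  have e5 : (prodBernoulli w).real (bernsteinCells a b c y 5) = PrW Finset.univ p (evQ ∅ a b c ∩ evU₁ (insert s(a, y) ∅) a b c) :=
    prodBernoulli_real_eq_PrW_univ w fun S => by
      simp only [Set.mem_inter_iff, mem_evQ, mem_evU₁, hap, bernsteinCells, Set.mem_compl_iff, hco]
      constructor
      · rintro ⟨⟨hab, hac, hbc⟩, hab' | hyb, hnc⟩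
        · exact absurd hab' hab
        · exact ⟨⟨⟨SimpleGraph.Reachable.symm hyb, hab⟩, hac⟩, hbc⟩
      · rintro ⟨⟨⟨hby, hab⟩, hac⟩, hbc⟩
        refine ⟨⟨hab, hac, hbc⟩, Or.inr (SimpleGraph.Reachable.symm hby), ?_⟩
        rintro (h | h)
        · exact hac h
        · have hby' : (openGraph (↑S : Set (Sym2 V))).Reachable b y := hby
          have hyc : (openGraph (↑S : Set (Sym2 V))).Reachable y c := h
          exact hbc (hby'.trans hyc)
  have e6 : (prodBernoulli w).real (bernsteinCells a b c y 6) = PrW Finset.univ p (evQ ∅ a b c ∩ evU₂ (insert s(a, y) ∅) a b c) :=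
    prodBernoulli_real_eq_PrW_univ w fun S => by
      simp only [Set.mem_inter_iff, mem_evQ, mem_evU₂, hap, bernsteinCells, Set.mem_compl_iff, hco]
      constructor
      · rintro ⟨⟨hab, hac, hbc⟩, hac' | hyc, hnb⟩
        · exact absurd hac' hac
        · exact ⟨⟨⟨SimpleGraph.Reachable.symm hyc, hab⟩, hac⟩, hbc⟩
      · rintro ⟨⟨⟨hcy, hab⟩, hac⟩, hbc⟩
        refine ⟨⟨hab, hac, hbc⟩, Or.inr (SimpleGraph.Reachable.symm hcy), ?_⟩
        rintro (h | h)
        · exact hab h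
        · have hyb : (openGraph (↑S : Set (Sym2 V))).Reachable y b := h
          have hcy' : (openGraph (↑S : Set (Sym2 V))).Reachable c y := hcy
          exact hbc (hyb.symm.trans hcy'.symm)
  have e7 : (prodBernoulli w).real (bernsteinCells a b c y 7) = PrW Finset.univ p (evU₁ ∅ a b c ∩ evT (insert s(a, y) ∅) a b c) :=
    prodBernoulli_real_eq_PrW_univ w fun S => by
      simp only [Set.mem_inter_iff, mem_evU₁, mem_evT, hap, bernsteinCells, Set.mem_compl_iff, hco]
      constructor
      · rintro ⟨⟨hab, hac⟩, _, hac' | hyc⟩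
        · exact absurd hac' hac
        · exact ⟨⟨hab, SimpleGraph.Reachable.symm hyc⟩, hac⟩
      · rintro ⟨⟨hab, hcy⟩, hac⟩
        exact ⟨⟨hab, hac⟩, Or.inl hab, Or.inr (SimpleGraph.Reachable.symm hcy)⟩
  have e8 : (prodBernoulli w).real (bernsteinCells a b c y 8) = PrW Finset.univ p (evU₂ ∅ a b c ∩ evT (insert s(a, y) ∅) a b c) :=
    prodBernoulli_real_eq_PrW_univ w fun S => by
      simp only [Set.mem_inter_iff, mem_evU₂, mem_evT, hap, bernsteinCells, Set.mem_compl_iff, hco]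
      constructor
      · rintro ⟨⟨hac, hab⟩, hab' | hyb, _⟩
        · exact absurd hab' hab
        · exact ⟨⟨hac, SimpleGraph.Reachable.symm hyb⟩, hab⟩
      · rintro ⟨⟨hac, hby⟩, hab⟩
        exact ⟨⟨hac, hab⟩, Or.inr (SimpleGraph.Reachable.symm hby), Or.inl hac⟩
  have e9 : (prodBernoulli w).real (bernsteinCells a b c y 9) = PrW Finset.univ p (evU₃ ∅ a b c ∩ evT (insert s(a, y) ∅) a b c) :=
    prodBernoulli_real_eq_PrW_univ w fun S => by
      simp only [Set.mem_inter_iff, mem_evU₃, mem_evT, hap, bernsteinCells, Set.mem_compl_iff, hco]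
      constructor
      · rintro ⟨⟨hbc, hab⟩, hab' | hyb, _⟩
        · exact absurd hab' hab
        · exact ⟨⟨hbc, SimpleGraph.Reachable.symm hyb⟩, hab⟩
      · rintro ⟨⟨hbc, hby⟩, hab⟩
        have hby' : (openGraph (↑S : Set (Sym2 V))).Reachable b y := hby
        have hbc' : (openGraph (↑S : Set (Sym2 V))).Reachable b c := hbc
        exact ⟨⟨hbc, hab⟩, Or.inr hby'.symm, Or.inr (hby'.symm.trans hbc')⟩
  rw [e0, e1, e2, e3, e4, e5, e6, e7, e8, e9]
  exact hst

/-- **(BΞ1) on every four-point bond-percolation law**, in the statement shape of `BernsteinPieceB1`. [this work] -/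
theorem xiBernsteinPieceB1 : ∀ (V : Type) [Fintype V] (w : Sym2 V → unitInterval) (a b c y : V),
    let m : Fin 10 → ℝ := fun i => (prodBernoulli w).real (bernsteinCells a b c y i)
    0 ≤ xiB₁ (m 0) (m 1) (m 2) (m 3) (m 4) (m 5) (m 6) (m 7) (m 8) (m 9) :=
  fun _ _ w a b c y => (xiBernsteinPieces w a b c y).1

/-- **(BΞ2) on every four-point bond-percolation law**. [this work] -/
theorem xiBernsteinPieceB2 : ∀ (V : Type) [Fintype V] (w : Sym2 V → unitInterval) (a b c y : V),
    let m : Fin 10 → ℝ := fun i => (prodBernoulli w).real (bernsteinCells a b c y i)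
    0 ≤ xiB₂ (m 0) (m 1) (m 2) (m 3) (m 4) (m 5) (m 6) (m 7) (m 8) (m 9) :=
  fun _ _ w a b c y => (xiBernsteinPieces w a b c y).2

/-- **(BΞ1),(BΞ2) in prim-bnk-1's vocabulary, every `n`** (no distinctness needed). [this work] -/
theorem xiStep_all {n : ℕ} (w : Sym2 (Fin n) → unitInterval) (a b c y : Fin n) :
    0 ≤ xiB₁ (E3GroupSepCert.lq w a b c) (E3GroupSepCert.lu₁ w a b c) (E3GroupSepCert.lu₂ w a b c) (E3GroupSepCert.lu₃ w a b c)
        (E3GroupSepCert.lt w a b c) (TerminalEdgeStep.lα₁ w a b c y) (TerminalEdgeStep.lα₂ w a b c y) (TerminalEdgeStep.lβ₁ w a b c y)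
        (TerminalEdgeStep.lβ₂ w a b c y) (TerminalEdgeStep.lβ₃ w a b c y) ∧
      0 ≤ xiB₂ (E3GroupSepCert.lq w a b c) (E3GroupSepCert.lu₁ w a b c) (E3GroupSepCert.lu₂ w a b c) (E3GroupSepCert.lu₃ w a b c)
        (E3GroupSepCert.lt w a b c) (TerminalEdgeStep.lα₁ w a b c y) (TerminalEdgeStep.lα₂ w a b c y) (TerminalEdgeStep.lβ₁ w a b c y)
        (TerminalEdgeStep.lβ₂ w a b c y) (TerminalEdgeStep.lβ₃ w a b c y) := by
  have hsym : ∀ u v : Fin n, (openConn u v : Set (BondConfig (Fin n))) = openConn v u := fun u v => by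
    ext ω; exact ⟨fun h => SimpleGraph.Reachable.symm h, fun h => SimpleGraph.Reachable.symm h⟩
  have c0 : E3GroupSepCert.lq w a b c = (prodBernoulli w).real (bernsteinCells a b c y 0) := by
    rw [E3GroupSepCert.lq, E3GroupSepCert.connEvent_pQ]; rfl
  have c1 : E3GroupSepCert.lu₁ w a b c = (prodBernoulli w).real (bernsteinCells a b c y 1) := by
    rw [E3GroupSepCert.lu₁, E3GroupSepCert.connEvent_pU₁]; rfl
  have c2 : E3GroupSepCert.lu₂ w a b c = (prodBernoulli w).real (bernsteinCells a b c y 2) := by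
    rw [E3GroupSepCert.lu₂, E3GroupSepCert.connEvent_pU₂]; rfl
  have c3 : E3GroupSepCert.lu₃ w a b c = (prodBernoulli w).real (bernsteinCells a b c y 3) := by
    rw [E3GroupSepCert.lu₃, E3GroupSepCert.connEvent_pU₃]; rfl
  have c4 : E3GroupSepCert.lt w a b c = (prodBernoulli w).real (bernsteinCells a b c y 4) := by
    rw [E3GroupSepCert.lt, E3GroupSepCert.connEvent_pT]; rfl
  have c5 : TerminalEdgeStep.lα₁ w a b c y = (prodBernoulli w).real (bernsteinCells a b c y 5) := by
    rw [TerminalEdgeStep.lα₁, TerminalEdgeStep.connEvent_pA₁, hsym y b]; congr 1; ext ω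
    simp only [bernsteinCells, Set.mem_inter_iff, Set.mem_compl_iff]; tauto
  have c6 : TerminalEdgeStep.lα₂ w a b c y = (prodBernoulli w).real (bernsteinCells a b c y 6) := by
    rw [TerminalEdgeStep.lα₂, TerminalEdgeStep.connEvent_pA₂, hsym y c]; congr 1; ext ω
    simp only [bernsteinCells, Set.mem_inter_iff, Set.mem_compl_iff]; tauto
  have c7 : TerminalEdgeStep.lβ₁ w a b c y = (prodBernoulli w).real (bernsteinCells a b c y 7) := by
    rw [TerminalEdgeStep.lβ₁, TerminalEdgeStep.connEvent_pB₁]; congr 1; ext ω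
    simp only [bernsteinCells, Set.mem_inter_iff, Set.mem_compl_iff]; tauto
  have c8 : TerminalEdgeStep.lβ₂ w a b c y = (prodBernoulli w).real (bernsteinCells a b c y 8) := by
    rw [TerminalEdgeStep.lβ₂, TerminalEdgeStep.connEvent_pB₂]; congr 1; ext ω
    simp only [bernsteinCells, Set.mem_inter_iff, Set.mem_compl_iff]; tauto
  have c9 : TerminalEdgeStep.lβ₃ w a b c y = (prodBernoulli w).real (bernsteinCells a b c y 9) := by
    rw [TerminalEdgeStep.lβ₃, TerminalEdgeStep.connEvent_pB₃]; congr 1; ext ω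
    simp only [bernsteinCells, Set.mem_inter_iff, Set.mem_compl_iff]; tauto
  rw [c0, c1, c2, c3, c4, c5, c6, c7, c8, c9]
  exact xiBernsteinPieces w a b c y

/-- **prim-bnk-1's AG⁺ terminal-edge rung for EVERY `N₀`**: `TerminalEdgeStep.XiStepUpTo N₀` (in the tree before only `xiStepUpTo_five`). [this work] -/
theorem xiStepUpTo_all (N₀ : ℕ) : TerminalEdgeStep.XiStepUpTo N₀ :=
  fun _ _ w a b c y _ _ _ _ _ _ => xiStep_all w a b c y

end AGPlusFibre

end Summit.CriticalPhenomena.PercolationContinuityZ3.Theorems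

end
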